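import Summits.QuantumFields.YangMills.Theses.ConvexGribovBody
import Summits.QuantumFields.YangMills.Theorems.ConvexGribovBodyStrongCouplingShape
import Literature.MathematicalPhysics.QuantumFieldTheory.LatticeGaugeProofs

/-!
# Disproof work file — crux `ConvexGribovBody.PoincareToGap` (stmt-QuantumFields-8781)

Standing disprover `refuter-cdisprove-stmt-QuantumFields-8781-0`, cycle 1 (2026-08-16).
Crux (rank 4, difficulty L): for every compact simple `G`, faithful unitary `r`, `β > 0`, `κ > 0`,
`S₀`: SLICE POINCARÉ (`Var_μ f ≤ κ · Σ_{ℓ spatial, t=0} ∫ |∇_ℓ f|² dμ` for all gauge-invariant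
link-Lipschitz `f` of the time-zero spatial links, on all tori `(2S+1)⁴`, `S ≥ S₀`) ⟹ `GapAt r β`
(volume-uniform exponential time-clustering of ALL pairs of gauge-invariant local observables,
`n ≤ S`, `S ≥ S₁`). VERDICT OF THIS CYCLE: **resists; no kill; no stub of the picked line
`cyclic-peeling` is false as stated.** Everything below is sorry-free; nothing asserts the crux or
any Theses decl positively except `crux_strongCoupling` (a restricted instance, from the tree's
already-landed `strongCouplingShape_proof`).

## Findings (index)

* §0 `slope`, `dir`, `SlicePoincare`, `GapAt`, `crux_iff` (definitional re-reading, `Iff.rfl`).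
* §1 WHY IT RESISTS (`crux_of_gapAt`, `exists_gapless_of_not_crux`, `crux_strongCoupling`): the
  conclusion is the lattice mass gap at the fixed coupling `β`; a counterexample must DISPROVE the
  volume-uniform lattice gap of a 4d compact-simple Yang–Mills theory at some `β > 0` (believed true
  at every `β`; for `0 < β < β₁(G,r)` it is the tree THEOREM `strongCouplingShape_proof`, so there the
  hypothesis is decoration) AND prove a volume-uniform equal-time Poincaré inequality at that `β`.
  No regime offers either half: bulk first-order points `β_t` of mixed-representation actions
  (`r = F ⊕ A^{⊕k}`, Bhanot–Creutz) break `GapAt` (phase coexistence on the torus) but break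
  `SlicePoincare` too (bimodal slice law: `Var ≈ 1/4`, `dir ≍ (2S+1)^{-3}` for the slice-averaged
  plaquette); second-order endpoints: both sides fail (`χ_slice → ∞`); `U(1)` (excluded anyway):
  Coulomb phase breaks both (`Var/dir ≍ 1/p_min ≍ S` for the soft photon); finite `G` (excluded):
  `dir ≡ 0` (§2), hypothesis unsatisfiable, instance vacuously true.
* §2 JUNK / BOUNDARY (proved): `slope_eq_zero_of_discrete`, `dir_eq_zero_of_discrete`,
  `slicePoincare_iff_of_discrete` (discrete `G`: the `limsup` over `𝓝[≠] = ⊥` is `sInf univ = 0`);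
  §2b `latticeConnectedCorr_add_period`, `…_add_mul_period` (torus time-correlations are
  `(2S+1)`-periodic in `n`).
* §3 THE PICKED LINE (stubs `stub_kernelVersion`, `stub_peelingDecay`, `stub_clusteringAssembly`,
  `stub_twoTimeRetention_of_slicePoincare`, skeleton sha 0154ad1a…): all four are TRUE ON PAPER given
  a gap (checked: kernel version = time-Markov property + Haar-averaging of the temporal layer at time
  `s-1`, which USES `IsGaugeInvariant f` essentially — for gauge-variant `f` the kernel version depends
  on the temporal links `(y,0)@(s-1)`, so stub 1 without `IsGaugeInvariant f` is false on paper;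
  peeling arithmetic `w + 2k + 3 ≤ 2S+1` matches `k = n − r_A − r_B − 2` peeling steps for `n ≤ S`;
  retention for one-slice `F` is `1 − (λ₁/λ₀)²`-type, two-sided one-slot conditioning retains only
  `O(gap²)` in the two-state toy, so expect `ε(β) ≍ gap²`, not `gap`). PROVED here: `Retention`
  (verbatim stub-4 conclusion body), `variance_eq_zero_of_retention_of_conserved`,
  `retention_var_eq_zero_of_conserved`, `retention_const_le_of_approx_conserved` — retention is
  incompatible with conserved slice observables; the SO(3) 't Hooft twist is conserved up to
  `O(ℓ S² e^{−cβ})`, which forces `S₁(β) ≳ e^{cβ/2}` in stub 4 for centreless `G` but kills nothing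
  (the stub's `∃ S₁` escapes beyond the monopole scale, where the crux hypothesis also starts to hold).
* §4 A FALSE NATURAL STRENGTHENING (now UNCONDITIONAL, split over landed/pending tree files):
  `GapAtAllSep` (drop `n ≤ S`) forces `Cov_S(A,B) = 0` on all large tori
  (`corr_zero_eq_zero_of_gapAtAllSep`, by §2b), refuted by any pair with `|Cov_S(A,B)| ≥ v > 0`
  along large tori (`not_gapAtAllSep_of_variance_lower_bound`). The variance lower bound IS PROVED
  (folder `neg/PlaquetteVariance.lean`, proposed as `Theorems/PoincareToGap/Negative/PlaquetteVariance.lean`,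
  p103077, dry-run ACCEPT): `Var_{μ_{β,S}}(Re tr ρ(U_p)) ≥ e^{−c|β|} · Var_Haar(Re tr ρ) > 0` for the
  time-zero `(1,2)`-plaquette, uniformly in `S ≥ 1`, for EVERY compact `G` with an element `≠ 1`,
  faithful unitary `r`, real `β` (`exists_plaquette_variance_lower_bound`; one-link heat-bath DLR
  identity `lintegral_heatBath_update` + volume-uniform heat-bath density bound
  `HaarResample.integral_le_exp_mul_integral_tilted` / `abs_wilsonAction_update_sub_le` from the
  FradkinShenkerFlow tree files + right invariance of Haar + faithfulness via
  `UnitaryCayley.re_trace_one_sub`), and `corr_S(A,A,0) = Var` (`latticeConnectedCorr_self_zero`),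
  so `not_clusteringAllSep_of_isCompactSimpleLieGroup : IsCompactSimpleLieGroup G → ∀ r β,
  ¬ GapAtAllSep r β` (composition file `neg/AllSeparations.lean`, to be proposed once p99901 and
  p103077 are in the tree). CLASS (of the strengthening, not of the crux): misstated — the repair
  is exactly the crux's `n ≤ S`.
* §5 LOAD-BEARING ANALYSIS (docstring `loadBearing_notes`): per hypothesis, on paper.
* §6 MECHANISM NOTE (docstring `mechanism_notes`): for a Kogut–Susskind Hamiltonian
  `H = −(2β)⁻¹ Δ_links + V` the ground-state transform gives the IDENTITY
  `⟨fΩ, (H−E₀) fΩ⟩ = (2β)⁻¹ ∫ |∇f|² Ω²`, i.e. `gap(H) = 1/(2β κ_{Ω²})` exactly (both directions);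
  Wilson's `T = e^{−H_eff}` is this up to `O(β^{-1/2})`-scale smoothing — the crux is "morally an
  identity", consistent with the rattack toy `gap·β·κ → 0.50`.

LANDING: `Theorems/PoincareToGap/Negative/Tightness.lean` (§2b, §3 abstract + stub form, §4, §2
discrete) — p99901 (dry-run ACCEPT, pending); `…/Negative/PlaquetteVariance.lean` (§4 variance and
covariance lower bounds) — p103077 (dry-run ACCEPT, pending); `…/Negative/AllSeparations.lean`
(composition: `¬ GapAtAllSep` for every compact simple `G`, `r`, `β`) — ready in the seat folder,
proposed once the two land. NUMERICS: kit job j017374 (retention calibration, §6).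
-/

namespace Summit.QuantumFields.YangMills.Cruxes.PoincareToGap.Disproof

open MeasureTheory Filter Topology Function
open Literature.MathematicalPhysics.QuantumFieldTheory
open Literature.MathematicalPhysics.QuantumLattice (torusLift configShift configShift_apply torusEdge
  LGConfig ZdEdge)
open Summit.QuantumFields.YangMills.Theses.ConvexGribovBody (PoincareToGap StrongCouplingShape)

noncomputable section

/-! ### §0 Vocabulary — verbatim sub-formulas of the crux -/

section Vocabulary

variable {G : Type} [Group G] [TopologicalSpace G] [IsTopologicalGroup G] [CompactSpace G]
  [MeasurableSpace G] [BorelSpace G]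

/-- The link metric slope `|∇_e f|(U)` of the crux (Frobenius metric pulled back by `r.ρ`). -/
def slope (r : LatticeRep G) (S : ℕ) (f : GaugeConfig 4 (2 * S + 1) G → ℝ)
    (U : GaugeConfig 4 (2 * S + 1) G) (e : Edge 4 (2 * S + 1)) : ℝ :=
  Filter.limsup (fun g : G => |f (Function.update U e g) - f U| /
    Real.sqrt (∑ a, ∑ b, ‖(r.ρ g - r.ρ (U e)) a b‖ ^ 2)) (𝓝[≠] (U e))

/-- The equal-time Dirichlet form `dir f = Σ_{ℓ spatial, t = 0} ∫ |∇_ℓ f|² dμ_{β,S}` of the crux. -/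
def dir (r : LatticeRep G) (β : ℝ) (S : ℕ) (f : GaugeConfig 4 (2 * S + 1) G → ℝ) : ℝ :=
  ∑ e : Edge 4 (2 * S + 1), (if e.1 0 = 0 ∧ e.2 ≠ 0 then
    ∫ U, (slope r S f U e) ^ 2 ∂(wilsonMeasure (d := 4) (L := 2 * S + 1) r.ρ β) else 0)

/-- `SlicePoincare r β κ S₀` — verbatim the crux HYPOTHESIS: on every torus `(2S+1)⁴`, `S ≥ S₀`,
`Var_μ f ≤ κ · dir f` for every gauge-invariant link-Lipschitz function `f` of the time-zero
spatial links. -/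
def SlicePoincare (r : LatticeRep G) (β κ : ℝ) (S₀ : ℕ) : Prop :=
  ∀ S : ℕ, S₀ ≤ S → ∀ f : GaugeConfig 4 (2 * S + 1) G → ℝ, IsGaugeInvariant f →
    (∀ U V : GaugeConfig 4 (2 * S + 1) G,
      (∀ e : Edge 4 (2 * S + 1), e.1 0 = 0 → e.2 ≠ 0 → U e = V e) → f U = f V) →
    (∃ K : ℝ, ∀ U V : GaugeConfig 4 (2 * S + 1) G,
      |f U - f V| ≤ K * ∑ e, Real.sqrt (∑ a, ∑ b, ‖(r.ρ (U e) - r.ρ (V e)) a b‖ ^ 2)) →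
    ∫ U, (f U - ∫ V, f V ∂(wilsonMeasure (d := 4) (L := 2 * S + 1) r.ρ β)) ^ 2
        ∂(wilsonMeasure (d := 4) (L := 2 * S + 1) r.ρ β) ≤ κ * dir r β S f

/-- `GapAt r β` — verbatim the crux CONCLUSION (= the `UniformLatticeGap` body at this `β`):
volume-uniform exponential time-clustering of all pairs of gauge-invariant local observables. -/
def GapAt (r : LatticeRep G) (β : ℝ) : Prop :=
  ∃ m : ℝ, 0 < m ∧ ∃ S₁ : ℕ, ∀ A B : YMSpecies G, ∃ C : ℝ, ∀ S n : ℕ, S₁ ≤ S → n ≤ S →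
    |latticeConnectedCorr r.ρ β (2 * S + 1) A.F B.F n| ≤ C * Real.exp (-(m * n))

end Vocabulary

/-- The crux re-read through `SlicePoincare` / `GapAt` (definitional). -/
theorem crux_iff : PoincareToGap ↔
    ∀ (G : Type) [Group G] [TopologicalSpace G] [IsTopologicalGroup G] [CompactSpace G]
      [MeasurableSpace G] [BorelSpace G], IsCompactSimpleLieGroup G → ∀ r : LatticeRep G,
      ∀ β : ℝ, 0 < β → ∀ κ : ℝ, 0 < κ → ∀ S₀ : ℕ, SlicePoincare r β κ S₀ → GapAt r β :=
  Iff.rfl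


/-! ### §1 Logical skeleton — why an outright kill is out of reach

The conclusion `GapAt r β` is the volume-uniform lattice mass gap at the fixed coupling `β`
(the `UniformLatticeGap` body). Hence:
* `crux_of_gapAt`: wherever the lattice gap holds the crux holds with the hypothesis UNUSED;
* `not_gapAt_of_counterexample`: every counterexample `(G, r, β, κ, S₀)` to the crux contains a
  proof that 4d lattice Yang–Mills with compact simple `G` has NO volume-uniform mass gap at the
  coupling `β > 0` — i.e. a disproof of the lattice mass-gap conjecture at some coupling (believed
  true at every `β > 0` for every compact simple `G`; Chatterjee Problem 5.1, tree
  `LatticeMassGapAllCouplings`), PLUS a proof of a volume-uniform equal-time Poincaré inequality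
  there. Neither half is available at any `β`: at strong coupling the gap is a THEOREM
  (`crux_strongCoupling`, from the tree's `strongCouplingShape_proof`), so the hypothesis is
  decoration for `0 < β < β₁(G, r)`; at weak coupling both halves are open.
-/

section Skeleton

variable {G : Type} [Group G] [TopologicalSpace G] [IsTopologicalGroup G] [CompactSpace G]
  [MeasurableSpace G] [BorelSpace G]

/-- Pointwise form: the gap at `β` gives the crux instance at `β` with the hypothesis unused. -/
theorem sliceImplication_of_gapAt (r : LatticeRep G) (β κ : ℝ) (S₀ : ℕ) (h : GapAt r β) :
    SlicePoincare r β κ S₀ → GapAt r β := fun _ => h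

/-- Every counterexample to the crux instance at `(r, β, κ, S₀)` refutes the lattice gap at `β`. -/
theorem not_gapAt_of_counterexample (r : LatticeRep G) (β κ : ℝ) (S₀ : ℕ)
    (h : ¬ (SlicePoincare r β κ S₀ → GapAt r β)) : SlicePoincare r β κ S₀ ∧ ¬ GapAt r β :=
  Classical.not_imp.mp h

end Skeleton

/-- If the volume-uniform lattice gap held at every `β > 0` for every compact simple `G` and
every `r` (the fixed-coupling shape of Chatterjee's Problem 5.1), the crux would follow with its
Poincaré hypothesis unused. -/
theorem crux_of_gapAt
    (h : ∀ (G : Type) [Group G] [TopologicalSpace G] [IsTopologicalGroup G] [CompactSpace G]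
      [MeasurableSpace G] [BorelSpace G], IsCompactSimpleLieGroup G → ∀ r : LatticeRep G,
      ∀ β : ℝ, 0 < β → GapAt r β) : PoincareToGap :=
  fun G _ _ _ _ _ _ hG r β hβ _ _ _ _ => h G hG r β hβ

/-- A refutation of the crux pins down a compact simple `G`, a representation `r` and a coupling
`β > 0` at which (i) the equal-time Poincaré inequality holds volume-uniformly and (ii) the
volume-uniform lattice mass gap FAILS. -/
theorem exists_gapless_of_not_crux (h : ¬ PoincareToGap) :
    ∃ (G : Type) (_ : Group G) (_ : TopologicalSpace G) (_ : IsTopologicalGroup G)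
      (_ : CompactSpace G) (_ : MeasurableSpace G) (_ : BorelSpace G),
      IsCompactSimpleLieGroup G ∧ ∃ (r : LatticeRep G) (β κ : ℝ) (S₀ : ℕ),
        0 < β ∧ 0 < κ ∧ SlicePoincare r β κ S₀ ∧ ¬ GapAt r β := by
  by_contra hne
  refine h fun G _ _ _ _ _ _ hG r β hβ κ hκ S₀ hP => ?_
  by_contra hgap
  exact hne ⟨G, _, _, ‹_›, ‹_›, _, ‹_›, hG, r, β, κ, S₀, hβ, hκ, hP, hgap⟩

/-- **The hypothesis is decoration at strong coupling.** For every compact simple `G` and `r`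
there is `β₁ > 0` (the tree's `betaOne 4 r.ρ / 4`, Osterwalder–Seiler) such that the crux
instance holds for all `0 < β < β₁`, all `κ` and all `S₀` — by `strongCouplingShape_proof`,
without looking at the Poincaré hypothesis. The crux therefore has content only for `β ≥ β₁`. -/
theorem crux_strongCoupling {G : Type} [Group G] [TopologicalSpace G] [IsTopologicalGroup G]
    [CompactSpace G] [MeasurableSpace G] [BorelSpace G] (hG : IsCompactSimpleLieGroup G)
    (r : LatticeRep G) :
    ∃ β₁ : ℝ, 0 < β₁ ∧ ∀ β : ℝ, 0 < β → β < β₁ → ∀ κ : ℝ, ∀ S₀ : ℕ,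
      SlicePoincare r β κ S₀ → GapAt r β := by
  obtain ⟨β₁, hβ₁, h⟩ := Summit.QuantumFields.YangMills.Theorems.strongCouplingShape_proof G hG r
  exact ⟨β₁, hβ₁, fun β hβ hβ' _ _ _ => h β hβ.le hβ'⟩

/-! ### §2 Boundary / junk facts (provable) -/

section Junk

variable {G : Type} [Group G] [TopologicalSpace G] [IsTopologicalGroup G] [CompactSpace G]
  [MeasurableSpace G] [BorelSpace G]

omit [IsTopologicalGroup G] [CompactSpace G] [MeasurableSpace G] [BorelSpace G] in
/-- **Finite gauge groups are outside the statement's reach.** For a DISCRETE `G` every point is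
isolated, `𝓝[≠] (U e) = ⊥`, and the `Filter.limsup` in the crux's metric slope is the junk value
`sInf univ = 0` of `ℝ`: the link slope vanishes identically. (`IsCompactSimpleLieGroup` demands
`ConnectedSpace G` and two non-commuting elements, which excludes this; the point is that the
equal-time Dirichlet form of the crux is void for `ℤ_N`-type gauge groups, so the
`ZnHiggsPhaseD4` barrier is respected vacuously, and that any repair towards finite `G` would
need a different Dirichlet form.) -/
theorem slope_eq_zero_of_discrete [DiscreteTopology G] (r : LatticeRep G) (S : ℕ)
    (f : GaugeConfig 4 (2 * S + 1) G → ℝ) (U : GaugeConfig 4 (2 * S + 1) G)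
    (e : Edge 4 (2 * S + 1)) : slope r S f U e = 0 := by
  have hbot : 𝓝[≠] (U e) = ⊥ := (discreteTopology_iff_nhds_ne.mp ‹_›) (U e)
  simp [slope, hbot, Filter.limsup, Filter.limsSup]

/-- Hence the whole Dirichlet form vanishes for discrete `G` … -/
theorem dir_eq_zero_of_discrete [DiscreteTopology G] (r : LatticeRep G) (β : ℝ) (S : ℕ)
    (f : GaugeConfig 4 (2 * S + 1) G → ℝ) : dir r β S f = 0 := by
  simp [dir, slope_eq_zero_of_discrete]

/-- … and the slice Poincaré hypothesis degenerates to "every admissible `f` has variance `≤ 0`",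
i.e. is unsatisfiable as soon as one admissible `f` has positive variance: for discrete `G` the
crux instance is vacuously TRUE, never a counterexample. -/
theorem slicePoincare_iff_of_discrete [DiscreteTopology G] (r : LatticeRep G) (β κ : ℝ)
    (S₀ : ℕ) : SlicePoincare r β κ S₀ ↔
    ∀ S : ℕ, S₀ ≤ S → ∀ f : GaugeConfig 4 (2 * S + 1) G → ℝ, IsGaugeInvariant f →
      (∀ U V : GaugeConfig 4 (2 * S + 1) G,
        (∀ e : Edge 4 (2 * S + 1), e.1 0 = 0 → e.2 ≠ 0 → U e = V e) → f U = f V) →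
      (∃ K : ℝ, ∀ U V : GaugeConfig 4 (2 * S + 1) G,
        |f U - f V| ≤ K * ∑ e, Real.sqrt (∑ a, ∑ b, ‖(r.ρ (U e) - r.ρ (V e)) a b‖ ^ 2)) →
      ∫ U, (f U - ∫ V, f V ∂(wilsonMeasure (d := 4) (L := 2 * S + 1) r.ρ β)) ^ 2
        ∂(wilsonMeasure (d := 4) (L := 2 * S + 1) r.ρ β) ≤ 0 := by
  simp only [SlicePoincare, dir_eq_zero_of_discrete, mul_zero]

end Junk

/-! ### §2b Periodicity of torus time-correlations — tightness of `n ≤ S` -/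

section Periodicity

variable {G : Type} [Group G] [MeasurableSpace G] {N : ℕ}

omit [Group G] in
/-- The periodic lift is invariant under a full time-translation by the period:
`τ_{(n+L)e₀} ∘ lift_L = τ_{n e₀} ∘ lift_L`. -/
theorem configShift_torusLift_add_period (L n : ℕ) (U : GaugeConfig 4 L G) :
    configShift (-Pi.single 0 ((n + L : ℕ) : ℤ)) (torusLift L U) =
      configShift (-Pi.single 0 (n : ℤ)) (torusLift L U) := by
  funext e
  simp only [configShift_apply, torusLift, Function.comp_apply, torusEdge]
  congr 2
  funext i
  simp only [Literature.Probability.LatticeModels.Torus.proj_apply, sub_neg_eq_add]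
  by_cases hi : i = 0
  · subst hi
    simp [Pi.single_eq_same]
  · simp [Pi.single_eq_of_ne hi]

/-- **Torus time-correlations are `(2S+1)`-periodic in the separation.** In particular
`corr(2S+1) = corr(0) = Cov(A, B)`: the restriction `n ≤ S` in the crux conclusion (and in
`HasLatticeMassGap`) cannot be dropped — see `not_gapAtAllSep_of_variance`. -/
theorem latticeConnectedCorr_add_period (ρ : G →* Matrix (Fin N) (Fin N) ℂ) (β : ℝ) (L : ℕ)
    [NeZero L] [TopologicalSpace G] [IsTopologicalGroup G] [CompactSpace G] [BorelSpace G]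
    (A B : LGConfig 4 G → ℝ) (n : ℕ) :
    latticeConnectedCorr ρ β L A B (n + L) = latticeConnectedCorr ρ β L A B n := by
  simp only [latticeConnectedCorr, configShift_torusLift_add_period]

/-- Iterated periodicity. -/
theorem latticeConnectedCorr_add_mul_period (ρ : G →* Matrix (Fin N) (Fin N) ℂ) (β : ℝ)
    (L : ℕ) [NeZero L] [TopologicalSpace G] [IsTopologicalGroup G] [CompactSpace G]
    [BorelSpace G] (A B : LGConfig 4 G → ℝ) (n k : ℕ) :
    latticeConnectedCorr ρ β L A B (n + k * L) = latticeConnectedCorr ρ β L A B n := by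
  induction k with
  | zero => simp
  | succ k ih => rw [Nat.succ_mul, ← add_assoc, latticeConnectedCorr_add_period, ih]

end Periodicity


/-! ### §3 The lead's line `cyclic-peeling` (skeleton 0154ad1a…, stubs registered 2026-08-16):
two-time variance RETENTION versus conserved slice observables

Stub `stub_twoTimeRetention_of_slicePoincare` converts the crux hypothesis into
`Retention r β ε S` below (verbatim its conclusion body) for all `S ≥ S₁`. The abstract content of
one retention inequality is `ε · Var F ≤ ‖F − E[F | 𝓕_out]‖²`. The lemmas of this section are
the structural constraint this puts on the torus theory:

* `variance_eq_zero_of_retention_of_conserved`: if `F` is (a.e. equal to) an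
  `𝓕_out`-measurable function — a slice observable CONSERVED across the arc — retention forces
  `Var F = 0`. So `Retention` is incompatible with any non-trivial exactly conserved bounded
  gauge-invariant slice observable (`retention_var_eq_zero_of_conserved`, in the stub's syntax).
* `retention_const_le_of_approx_conserved`: approximate conservation
  `‖F − E[F | 𝓕_out]‖² ≤ η` with `Var F ≥ v > 0` forces `ε ≤ η / v`.

ON PAPER (not constructible here; same objects as the sibling disproof of stmt-9441, §2 of
`Cruxes/SusceptibilityToPoincare/Disproof.lean`, and the rattack log EVIDENCE.md §5 of this item):
for the centreless admissible group `G = SO(3)` (connected, non-abelian, no proper closed connected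
normal subgroup, faithful unitary 3-dim rep — admitted by `IsCompactSimpleLieGroup`) the 't Hooft
magnetic twist of a time slice, `η₁₂(x₃; U_s) = ∏_{p ⊂ (1,2)-plane at height x₃, time s} sign tr_F(Ũ_p)`
(`Ũ` any SU(2) lift; lift-independent on a closed plane), is a bounded measurable gauge-invariant
function of the spatial links of ONE slice (so it is an admissible `F` of the stub, which asks
measurability only — no continuity, no Dirichlet form), and `η₁₂(x₃; s) · η₁₂(x₃; s+1) = ∏ (ℤ₂-monopole
indicators of the (2S+1)² cubes p × [s, s+1])`; a monopole cube needs a plaquette far from `±1`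
(SU(2) Bianchi identity), so `P(η flips across the arc) ≤ ℓ (2S+1)² K e^{−cβ}`. With sector balance
`v = Var η ≈ 1/4` (confinement folklore, 't Hooft 1979; de Forcrand–Jahn 2003) the quantitative lemma
gives `ε ≤ 4 ℓ (2S+1)² K e^{−cβ}` on every torus with `S₁ ≤ S`. This does NOT kill the stub: its
`∃ S₁` may be taken beyond the monopole scale `S ≍ e^{cβ/2}`, where `η` decorrelates in one step
and imposes nothing; and in the window `S ≪ e^{cβ/2}` the crux HYPOTHESIS fails as well (the
mollified twist indicator has `Var ≈ 1/4`, `dir ≲ δ⁻² (2S+1)² e^{−c'β}`), so the assembly's `S₀(β)`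
coming from K1/K2 must itself lie beyond that scale (flag already raised against K1 = stmt-8779 by
the rattack seat). RECORDED CONSEQUENCE for the lead: `ε` and `S₁` in stub 4 cannot be chosen
uniformly in `β`; any proof must let `S₁(β) → ∞` (at least like `e^{cβ/2}` for centreless `G`).
-/

section Retention

variable {Ω : Type*} {m m₀ : MeasurableSpace Ω} {μ : Measure Ω}

/-- **Retention kills conserved observables (abstract form).** If `F` is a.e. equal to an
`m`-measurable function then `E[F | m] = F` a.e., the retained conditional variance vanishes, and
a retention inequality with `ε > 0` forces `Var F = 0`. -/
theorem variance_eq_zero_of_retention_of_conserved [IsFiniteMeasure μ] (hm : m ≤ m₀)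
    {F : Ω → ℝ} (hF : AEStronglyMeasurable[m] F μ) (hFi : Integrable F μ) {ε : ℝ} (hε : 0 < ε)
    (hR : ε * ∫ x, (F x - ∫ y, F y ∂μ) ^ 2 ∂μ ≤ ∫ x, (F x - (μ[F|m]) x) ^ 2 ∂μ) :
    ∫ x, (F x - ∫ y, F y ∂μ) ^ 2 ∂μ = 0 := by
  have hae : μ[F|m] =ᵐ[μ] F := condExp_of_aestronglyMeasurable' hm hF hFi
  have h0 : ∫ x, (F x - (μ[F|m]) x) ^ 2 ∂μ = 0 := by
    have : (fun x => (F x - (μ[F|m]) x) ^ 2) =ᵐ[μ] fun _ => (0 : ℝ) := by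
      filter_upwards [hae] with x hx
      simp [hx]
    rw [integral_congr_ae this, integral_zero]
  have hnn : 0 ≤ ∫ x, (F x - ∫ y, F y ∂μ) ^ 2 ∂μ := integral_nonneg fun _ => sq_nonneg _
  rw [h0] at hR
  nlinarith [mul_nonneg hε.le hnn]

omit [m : MeasurableSpace Ω] in
/-- **Approximate conservation bounds the retention constant.** `ε · Var F ≤ ‖F − E[F|m]‖² ≤ η`
and `Var F ≥ v > 0` give `ε ≤ η / v`. (For the SO(3) twist: `η ≲ ℓ (2S+1)² e^{−cβ}`, `v ≈ 1/4`.) -/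
theorem retention_const_le_of_approx_conserved {V R ε η v : ℝ} (hR : ε * V ≤ R) (hη : R ≤ η)
    (hv : v ≤ V) (hv0 : 0 < v) (hε : 0 ≤ ε) : ε ≤ η / v := by
  rw [le_div_iff₀ hv0]
  calc ε * v ≤ ε * V := mul_le_mul_of_nonneg_left hv hε
    _ ≤ η := hR.trans hη

end Retention

section RetentionStub

variable {G : Type} [Group G] [TopologicalSpace G] [IsTopologicalGroup G] [CompactSpace G]
  [MeasurableSpace G] [BorelSpace G]

/-- `Retention r β ε S` — verbatim the body of the conclusion of the lead's stub
`stub_twoTimeRetention_of_slicePoincare` (and of the retention hypothesis of `stub_peelingDecay`)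
on the torus of side `2S+1`: two-slice gauge-invariant bounded measurable `F` keep the fraction
`ε` of their variance when the time-arc `[s, s+ℓ-1]` is resampled given its complement. -/
def Retention (r : LatticeRep G) (β ε : ℝ) (S : ℕ) : Prop :=
  ∀ μ : Measure (GaugeConfig 4 (2 * S + 1) G),
    μ = (wilsonMeasure r.ρ β : Measure (GaugeConfig 4 (2 * S + 1) G)) →
    ∀ (s : ZMod (2 * S + 1)) (ℓ : ℕ), 3 ≤ ℓ → ℓ + 3 ≤ 2 * S + 1 →
    ∀ F : GaugeConfig 4 (2 * S + 1) G → ℝ, Measurable F → (∃ M : ℝ, ∀ U, |F U| ≤ M) →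
    IsGaugeInvariant F →
    DependsOn F {e : Edge 4 (2 * S + 1) | ((e.1 0 - s).val = 0 ∨ (e.1 0 - s).val = ℓ - 1) ∧
      e.2 ≠ 0} →
    ε * ∫ U, (F U - ∫ V, F V ∂μ) ^ 2 ∂μ ≤
      ∫ U, (F U - condExp (cylinderEvents {e : Edge 4 (2 * S + 1) | ℓ ≤ (e.1 0 - s).val}) μ F U)
        ^ 2 ∂μ

/-- The lead's stub 4, re-read: crux hypothesis ⟹ `∃ ε ∈ (0,1], ∃ S₁, ∀ S ≥ S₁, Retention`.
(Recorded for reference; typed over `SlicePoincare`, definitionally the stub's hypothesis.) -/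
def StubTwoTimeRetention : Prop :=
  ∀ (G : Type) [Group G] [TopologicalSpace G] [IsTopologicalGroup G] [CompactSpace G]
    [MeasurableSpace G] [BorelSpace G], IsCompactSimpleLieGroup G → ∀ (r : LatticeRep G) (β : ℝ),
    0 < β → ∀ κ : ℝ, 0 < κ → ∀ S₀ : ℕ, SlicePoincare r β κ S₀ →
    ∃ ε : ℝ, 0 < ε ∧ ε ≤ 1 ∧ ∃ S₁ : ℕ, ∀ S : ℕ, S₁ ≤ S → Retention r β ε S

/-- **In the stub's own syntax:** under `Retention r β ε S` with `ε > 0`, every admissible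
two-slice observable `F` that is a.e. equal to a function of the links OUTSIDE the arc (a
conserved slice quantity) has variance zero under the torus Wilson measure. A non-trivial
conserved bounded gauge-invariant slice observable at `(β, S)` with `S ≥ S₁` would therefore
refute stub 4's conclusion outright; the SO(3) twist is one up to `O(ℓ S² e^{−cβ})`. -/
theorem retention_var_eq_zero_of_conserved (r : LatticeRep G) {β ε : ℝ} {S : ℕ}
    (h : Retention r β ε S) (hε : 0 < ε) (s : ZMod (2 * S + 1)) (ℓ : ℕ) (h3 : 3 ≤ ℓ)
    (hℓ : ℓ + 3 ≤ 2 * S + 1) (F : GaugeConfig 4 (2 * S + 1) G → ℝ) (hFm : Measurable F)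
    (hFb : ∃ M : ℝ, ∀ U, |F U| ≤ M) (hFg : IsGaugeInvariant F)
    (hFd : DependsOn F {e : Edge 4 (2 * S + 1) |
      ((e.1 0 - s).val = 0 ∨ (e.1 0 - s).val = ℓ - 1) ∧ e.2 ≠ 0})
    (hcons : AEStronglyMeasurable[cylinderEvents {e : Edge 4 (2 * S + 1) | ℓ ≤ (e.1 0 - s).val}]
      F (wilsonMeasure (d := 4) (L := 2 * S + 1) r.ρ β)) :
    ∫ U, (F U - ∫ V, F V ∂(wilsonMeasure (d := 4) (L := 2 * S + 1) r.ρ β)) ^ 2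
      ∂(wilsonMeasure (d := 4) (L := 2 * S + 1) r.ρ β) = 0 := by
  haveI := isProbabilityMeasure_wilsonMeasure (d := 4) (L := 2 * S + 1) r.ρ r.continuous β
  obtain ⟨M, hM⟩ := hFb
  have hFi : Integrable F (wilsonMeasure (d := 4) (L := 2 * S + 1) r.ρ β) :=
    Integrable.of_bound hFm.aestronglyMeasurable M (Eventually.of_forall fun U => by
      simpa [Real.norm_eq_abs] using hM U)
  exact variance_eq_zero_of_retention_of_conserved cylinderEvents_le_pi hcons hFi hε
    (h _ rfl s ℓ h3 hℓ F hFm ⟨M, hM⟩ hFg hFd)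

end RetentionStub

/-! ### §4 A natural strengthening that IS false: clustering at all separations

`GapAtAllSep` drops `n ≤ S` from the conclusion. By periodicity (`§2b`) `corr(k(2S+1)) = corr(0)`,
so `GapAtAllSep` forces `corr_S(A, B, 0) = Cov_S(A, B) = 0` on all large tori for EVERY pair —
false as soon as one gauge-invariant local observable has variance bounded below along the tori.
`not_gapAtAllSep_of_variance_lower_bound` is that reduction; the variance lower bound itself
(`Var_{μ_{β,S}}(plaquette) ≥ e^{-c|β|} Var_Haar(Re tr ρ) > 0`, `S ≥ 1`, every compact `G` with an
element `≠ 1`, every real `β`) is PROVED in the seat file `neg/PlaquetteVariance.lean` =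
`Theorems/PoincareToGap/Negative/PlaquetteVariance.lean` (p103077) — not inlined here only to keep
this work file importable before that proposal lands; the composition `¬ GapAtAllSep r β` for every
compact simple `G` is `Negative/AllSeparations.lean` (seat folder, 40 lines). -/

section AllSeparations

variable {G : Type} [Group G] [TopologicalSpace G] [IsTopologicalGroup G] [CompactSpace G]
  [MeasurableSpace G] [BorelSpace G]

/-- The conclusion with the restriction `n ≤ S` dropped. -/
def GapAtAllSep (r : LatticeRep G) (β : ℝ) : Prop :=
  ∃ m : ℝ, 0 < m ∧ ∃ S₁ : ℕ, ∀ A B : YMSpecies G, ∃ C : ℝ, ∀ S n : ℕ, S₁ ≤ S →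
    |latticeConnectedCorr r.ρ β (2 * S + 1) A.F B.F n| ≤ C * Real.exp (-(m * n))

/-- `GapAtAllSep` forces every equal-time covariance `corr_S(A, B, 0)` to vanish on large tori. -/
theorem corr_zero_eq_zero_of_gapAtAllSep (r : LatticeRep G) (β : ℝ) (h : GapAtAllSep r β) :
    ∃ S₁ : ℕ, ∀ A B : YMSpecies G, ∀ S : ℕ, S₁ ≤ S →
      latticeConnectedCorr r.ρ β (2 * S + 1) A.F B.F 0 = 0 := by
  obtain ⟨m, hm, S₁, h⟩ := h
  refine ⟨S₁, fun A B S hS => ?_⟩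
  obtain ⟨C, hC⟩ := h A B
  -- `|corr 0| = |corr (k (2S+1))| ≤ C e^{-m k (2S+1)} → 0`
  have hper : ∀ k : ℕ, latticeConnectedCorr r.ρ β (2 * S + 1) A.F B.F (k * (2 * S + 1)) =
      latticeConnectedCorr r.ρ β (2 * S + 1) A.F B.F 0 := fun k => by
    simpa using latticeConnectedCorr_add_mul_period r.ρ β (2 * S + 1) A.F B.F 0 k
  have hbound : ∀ k : ℕ, |latticeConnectedCorr r.ρ β (2 * S + 1) A.F B.F 0| ≤
      C * Real.exp (-(m * ((k * (2 * S + 1) : ℕ) : ℝ))) := fun k => by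
    rw [← hper k]; exact hC S _ hS
  have hlim : Tendsto (fun k : ℕ => C * Real.exp (-(m * ((k * (2 * S + 1) : ℕ) : ℝ))))
      atTop (𝓝 (C * 0)) := by
    refine tendsto_const_nhds.mul ?_
    refine Real.tendsto_exp_atBot.comp ?_
    rw [tendsto_neg_atBot_iff]
    refine Tendsto.const_mul_atTop hm ?_
    refine tendsto_natCast_atTop_atTop.comp ?_
    exact tendsto_atTop_mono (fun k => Nat.le_mul_of_pos_right k (by omega)) tendsto_id
  rw [mul_zero] at hlim
  have := ge_of_tendsto' hlim hbound
  exact abs_eq_zero.mp (le_antisymm this (abs_nonneg _))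

/-- **Rigorous half of the refutation of `GapAtAllSep`:** one pair of gauge-invariant local
observables whose equal-time torus covariance stays `≥ v > 0` (or `≤ -v`) along arbitrarily
large tori refutes clustering at all separations. -/
theorem not_gapAtAllSep_of_variance_lower_bound (r : LatticeRep G) (β : ℝ) (A B : YMSpecies G)
    {v : ℝ} (hv : 0 < v)
    (hA : ∀ S₁ : ℕ, ∃ S : ℕ, S₁ ≤ S ∧ v ≤ |latticeConnectedCorr r.ρ β (2 * S + 1) A.F B.F 0|) :
    ¬ GapAtAllSep r β := fun h => by
  obtain ⟨S₁, h⟩ := corr_zero_eq_zero_of_gapAtAllSep r β h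
  obtain ⟨S, hS, hvS⟩ := hA S₁
  rw [h A B S hS, abs_zero] at hvS
  exact absurd hvS (not_le.mpr hv)

end AllSeparations


/-! ### §5–§6 Load-bearing analysis and mechanism (paper level; nothing here is Lean-decidable —
every quantity is a Haar/Wilson integral on `G^E` over a genuine compact simple Lie group) -/

/-- **§5 Load-bearing analysis of the crux hypotheses (on paper).**

* `IsCompactSimpleLieGroup G` — NOT load-bearing for the implication: "volume-uniform slice
  Poincaré ⟹ volume-uniform gap" is expected for every compact `G`. `U(1)₄`: Coulomb phase at large
  `β` has neither (soft photon: `Var/dir ≍ S`); finite `G`: `dir ≡ 0` (§2), vacuous. It IS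
  load-bearing for the ROUTE (K1/K2 false for `U(1)`), not for K3.
* `0 < β` — possibly unnecessary: at `β = 0` links are independent Haar, `GapAt` holds trivially
  (and slice Poincaré holds by tensorisation + `λ₁(G) > 0`). `β < 0`: unknown, irrelevant.
* `0 < κ` — decoration: for `κ ≤ 0` the hypothesis says `Var f ≤ 0` for all admissible `f`,
  unsatisfiable (a time-zero spatial plaquette is admissible with `Var > 0`).
* `IsGaugeInvariant f` in the hypothesis — possibly unnecessary (gauge-orbit directions carry Haar
  measure, Poincaré constant `1/λ₁(G)` along orbits); it only WEAKENS the hypothesis, and the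
  prover needs it only for `f = ψ₁/Ω`-type functions, which are gauge-invariant.
* Lipschitz side condition — technical (makes `slope ≤ K`, `dir f ≤ 3(2S+1)³K²`, rattack JunkFree);
  possibly unnecessary.
* "depends only on time-zero spatial links" — gives the hypothesis its content: without it `dir`
  (time-zero spatial gradients only) vanishes for functions of other links and the hypothesis is
  unsatisfiable (instance vacuously true, not false).
* `∀ S ≥ S₀` (volume-uniformity of `κ`) — ESSENTIAL and correctly placed: per-`S` Poincaré is
  always true (compact manifold, smooth positive density), so all content is uniformity; the
  femto-universe window `S ≲ ξ(β)` (Lüscher zero modes: `Var ≍ 1`, `dir ≍ S⁻³`) and, for centreless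
  `G`, the twist window `S ≲ e^{cβ/2}` (§3) show `S₀(β) → ∞` is forced.
* `n ≤ S` in the conclusion — ESSENTIAL (§4: periodicity).
* `∃ S₁` in the conclusion — harmless but used: lets the prover discard the same windows. -/
theorem loadBearing_notes : True := trivial

/-- **§6 Mechanism note (why the crux is "morally an identity").** For a Schrödinger-type lattice
Hamiltonian `H = −(2β)⁻¹ Σ_ℓ Δ_ℓ + V(U)` on `L²(G^{E₀}, Haar)` with ground state `Ω > 0`,
`HΩ = E₀Ω`, the ground-state (Doob) transform is the identity
`⟨fΩ, (H − E₀)(fΩ)⟩ = (2β)⁻¹ ∫ Σ_ℓ |∇_ℓ f|² Ω² dU` for smooth `f`, so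
`gap(H) = inf_{f ⊥_{Ω²} 1} ⟨fΩ,(H−E₀)fΩ⟩/‖fΩ‖² = 1/(2β · κ(Ω²))` where `κ(Ω²)` is the OPTIMAL Poincaré
constant of the vacuum law for the link Dirichlet form — slice Poincaré and the gap are then the
SAME number (free massive field: `κ = 1/(2m)`, rate `m`, the card's calibration; rattack toy
`gap·β·κ → 0.50`). Wilson's transfer matrix is `T = K^{1/2}_V ∘ (⊗_ℓ heat-kernel-like k_β) ∘ K^{1/2}_V`
restricted to gauge-invariant states, `= e^{−H_eff}` with `H_eff = H_KS + O(β^{-1})` only formally;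
the two genuine gaps between the crux and the identity are (a) `T` versus `e^{−H_KS}` (one step moves
every link by `β^{-1/2}`: the Dirichlet form of the Doob chain is `E_T̂(f) = ½∫∫(f(U)−f(U'))² Ω T Ω'/λ₀`,
whose second-order Taylor part is `≥ (c/β)·dir(f)` because drift cross-terms enter as a square,
the issue being the remainder for `f` rough at scale `β^{-1/2}` in many links at once), and (b) the
thermal trace at period `2S+1` versus `Ω²` (both the hypothesis and the conclusion are thermal, which
the picked line `cyclic-peeling` exploits by never leaving the torus measure). Neither gap is a
source of counterexamples: both are approximation issues inside a proof, not falsity mechanisms.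

**Calibration of the picked line's retention constant** (kit job `j017374`, this seat, script
`toy_retention.py`; evidence `compute-j017374.json` on the item). Two exactly solvable rings of
`P` time slices, worst retention ratio `ε(ℓ,P) = inf_F E Var(F | 𝓕_out) / Var F` over ALL `L²`
functions `F` of the two slices `s`, `s+ℓ−1` (= `1 − ρ_max²`, maximal correlation; exact linear
algebra): (A) free massive lattice field (Gaussian ring, precision `β(−Δ + m²)`, gap `w`,
`cosh w = 1 + m²/2`): `ε(ℓ,P) ↑ 1 − e^{−2w}` at mid-arc, the binding case is `ℓ = 3` (and `P − 3`)
with `ε(3,∞)/(1 − e^{−2w}) ≈ 0.98 (m=1), 0.77 (m=0.3), 0.60 (m=0.1)`, uniformly in `P ≥ 21, 61`;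
but for rings SHORTER than the correlation length (`P = 9`, `m = 0.1`) `ε ≈ 0.043 ≈ m²P/2`
(zero-mode dominated) — so `ε ≍ gap` needs `S₁ ≳ ξ(β)`, below that `ε ≍ gap² · S`; `1/(βκ) = 2w`
to four digits at `P = 61` (the identity of §6). (B) 2d `U(1)` Yang–Mills on `L₁ × P` (slice =
holonomy, `t_j = (I_j(β)/I_0(β))^{L₁}`, the rattack toy family): `ε_pair(3, P)/(1 − t₁²) ≈ 0.70–0.94`,
mid-arc `→ 1 − t₁²` exactly, `ε_oneslice(ℓ=1) ≈ 0.57–0.80 · (1−t₁²)`, all uniform in `P ∈ {9,15,31}`;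
`gap·β·κ = 0.72, 0.55, 0.55, 0.51` for `(β,L₁) = (2,2),(6,3),(6,12),(20,10)` (→ 1/2). READING: stub 4
is calibrated like the crux — `ε ≍ 1 − e^{−2m} ≍ 1/(βκ)` once `S₁ ≳ ξ`; nothing anomalous at small `ℓ`
or short outside arcs; `ℓ ≥ 3` is not needed for positivity in the free models (ℓ = 1, 2 are fine).

**Barrier catalogue** (`Literature/Barriers/QuantumFields/`, 120 files scanned by name; relevant
blocks read): none bites an implication "volume-uniform slice Poincaré ⟹ volume-uniform gap at fixed
β" on SYMMETRIC tori `(2S+1)⁴`. `FiniteTemperatureDeconfinement` (Borgs–Seiler) would bite a variant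
with FIXED temporal extent `L₀` and `S → ∞` at large `β` (Polyakov-loop order ⟹ no clustering of some
gauge-invariant pairs), which the crux avoids by tying the period to `2S+1`; `RougheningTransition`
concerns the string-tension series only (its own evasions (a)); `FixedCouplingUltralocality` concerns
the continuum limit at fixed `β` (the Leg, not K3). -/
theorem mechanism_notes : True := trivial

end

end Summit.QuantumFields.YangMills.Cruxes.PoincareToGap.Disproof
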